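import Summits.QuantumFields.BalabanUV.Beta.GAN24.DirichletBoxRegularity

/-!
# `BalabanUV.Beta.GAN24.DirichletBoxRegularityLocal` — binder row G-an2-4 / (CONV-C), road P2 PART IV, leaf L10: THE DISCRETE `H²` IDENTITY
# WITH A SUPPORT-RELATIVE CORNER CONDITION (module M-R localised; unit b2b-balaban-gan24-p2, gen 24, v1)

HONEST FRAMING (cell contract, verbatim): «discharging `BetaPertH` makes Bałaban's UV stability UNCONDITIONAL — a real constructive-QFT
result; it is NOT the continuum limit and NOT the Clay problem.»  Module M-R (`DirichletBoxRegularity`, PART II) proves the discrete `H²`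
identity `Σ_{x∈Ω}|Δz|² = Σ_μΣ_{x∈Ω}|P_μz|² + Σ_{μ≠ν}‖∂_μ∂_νz‖²` for `z ⊂ Ω` on a CORNER-FREE region `Ω`.  Its proof uses corner-freeness only
through the vanishing of the exterior cross terms `conj((P_μz)(x))·(P_νz)(x)`, `x ∉ Ω`, `μ ≠ ν`.  This file records the identity and the
regularity inequality under exactly that hypothesis (**`sum_normSq_LapS_eq_of_cross`**, **`hdiag_le_sum_normSq_LapS_of_cross`**), and the
two pointwise ways to meet it: the region is corner-free AT `x` (`cross_eq_zero_of_cornerFreeAt`), or `z` vanishes on the `2d` neighbours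
of `x` (`cross_eq_zero_of_vanish_nhds`) — so that a CUT-OFF field `χ·u` on a general union of unit blocks, with `χ ≡ 0` near every
re-entrant vertex/edge, enjoys the corner-free `H²` bound although the region is not corner-free (memo
`HOME/b2b-balaban-gan24-p2/gen24/W-FULL-WEIGHTED.md` §3, leaf L10 of the weighted-regularity programme behind the weighted socket p234489).

ABSOLUTE RULE (cell, verbatim): «No internally-minted statement may enter as a cited fact. Every hypothesis is either kernel-proved in
this package or a verbatim quotation of a PUBLISHED theorem with page reference. The manuscript(s) under audit are NOT citable for
their own disputed steps — they are the thing under adjudication; programme-internal (2001/route/tribunal) claims are never citable.»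
[folklore] finite lattice calculus; nothing printed is a hypothesis.  NOT CLAIMED: the weighted estimates (A)/(B), NE2, (CONV-C) as a whole,
`BetaPertH`, continuum, Clay.  «not in print; our proof attempt».  HONEST DEPENDENCY: continuum YM on T⁴ ⇐ BetaPertH ∧ nine spine
estimates (0/9 proved); BetaPertH ⇐ (D1) ∧ (D4) ∧ CAP+tail; G-an2-4 gates asym, D1 and NE2/3/4.
-/

noncomputable section

open scoped BigOperators ComplexConjugate Matrix
open Finset

namespace Summit.QuantumFields.BalabanUV.Beta.GAN24.DirichletBoxRegularityLocal

open Literature.MathematicalPhysics.QuantumFieldTheory.Balaban1983to89.B5Prop11Plancherel (Tor unitVec)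
open Literature.MathematicalPhysics.QuantumFieldTheory.Balaban1983to89.B5Action121 (sdiff LapS)
open Literature.MathematicalPhysics.QuantumFieldTheory.Balaban1983to89.B5Prop11Lower (nsq nsq_nonneg)
open Summit.QuantumFields.BalabanUV.Beta.GAN24.DirichletBoxRegularity

variable {d : ℕ} {N : Fin d → ℕ} [hN : ∀ μ, NeZero (N μ)]

/-! ## §1 Two pointwise sources of vanishing exterior cross terms -/

/-- **corner-free AT a site**: if the exterior site `x` satisfies the corner-free implication for the pair `(μ, ν)`, the cross term of
`P_μz` and `P_νz` at `x` vanishes for every `z ⊂ Ω` (M-R `cross_eq_zero_of_not_mem`, pointwise). [folklore] -/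
theorem cross_eq_zero_of_cornerFreeAt {Ω : Finset (Tor N)} {z : Tor N → ℂ} (hz : SuppIn N Ω z) (c : ℂ) {μ ν : Fin d}
    {x : Tor N} (hx : x ∉ Ω)
    (hcf : (x + unitVec N μ ∈ Ω ∨ x - unitVec N μ ∈ Ω) → (x + unitVec N ν ∉ Ω ∧ x - unitVec N ν ∉ Ω)) :
    conj ((Pdir N c μ *ᵥ z) x) * (Pdir N c ν *ᵥ z) x = 0 := by
  by_cases h : x + unitVec N μ ∈ Ω ∨ x - unitVec N μ ∈ Ω
  · obtain ⟨hp, hm⟩ := hcf h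
    rw [Pdir_mulVec_eq_zero_of_not_mem hz c hx hp hm, mul_zero]
  · obtain ⟨hp, hm⟩ := not_or.mp h
    rw [Pdir_mulVec_eq_zero_of_not_mem hz c hx hp hm, map_zero, zero_mul]

/-- a field vanishing at `x` and at its two `μ`-neighbours carries no `P_μ z` at `x`. [folklore] -/
theorem Pdir_mulVec_eq_zero_of_vanish (c : ℂ) {μ : Fin d} {z : Tor N → ℂ} {x : Tor N} (h0 : z x = 0)
    (hp : z (x + unitVec N μ) = 0) (hm : z (x - unitVec N μ) = 0) : (Pdir N c μ *ᵥ z) x = 0 := by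
  rw [Pdir_mulVec, h0, hp, hm]
  ring

/-- **vanishing neighbourhood**: if `z ⊂ Ω` vanishes at the two `μ`-neighbours of the exterior site `x`, the cross term at `x` vanishes
(whatever the geometry of `Ω` at `x`). [folklore] -/
theorem cross_eq_zero_of_vanish_nhds {Ω : Finset (Tor N)} {z : Tor N → ℂ} (hz : SuppIn N Ω z) (c : ℂ) {μ ν : Fin d}
    {x : Tor N} (hx : x ∉ Ω) (hp : z (x + unitVec N μ) = 0) (hm : z (x - unitVec N μ) = 0) :
    conj ((Pdir N c μ *ᵥ z) x) * (Pdir N c ν *ᵥ z) x = 0 := by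
  rw [Pdir_mulVec_eq_zero_of_vanish c (hz x hx) hp hm, map_zero, zero_mul]

/-! ## §2 The `H²` identity and inequality under the support-relative cross condition -/

/-- for `μ ≠ ν` the `Ω`-restricted cross sum equals the full torus pairing, given vanishing exterior cross terms. [folklore] -/
theorem sum_cross_eq_dotProduct_of_cross {Ω : Finset (Tor N)} {z : Tor N → ℂ} (c : ℂ) {μ ν : Fin d}
    (hcross : ∀ x, x ∉ Ω → conj ((Pdir N c μ *ᵥ z) x) * (Pdir N c ν *ᵥ z) x = 0) :
    ∑ x ∈ Ω, conj ((Pdir N c μ *ᵥ z) x) * (Pdir N c ν *ᵥ z) x = star (Pdir N c μ *ᵥ z) ⬝ᵥ (Pdir N c ν *ᵥ z) := by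
  rw [Finset.sum_subset (Finset.subset_univ Ω) (fun x _ hx => hcross x hx)]
  rfl

/-- **THE DISCRETE `H²` IDENTITY UNDER THE SUPPORT-RELATIVE CROSS CONDITION**: if every exterior cross term vanishes,
`Σ_{x∈Ω}|(Δz)(x)|² = Σ_μ Σ_{x∈Ω}|(P_μz)(x)|² + Σ_μ Σ_{ν≠μ} ‖∂_μ∂_νz‖²`. [folklore] -/
theorem sum_normSq_LapS_eq_of_cross {Ω : Finset (Tor N)} {z : Tor N → ℂ} (c : ℂ)
    (hcross : ∀ x, x ∉ Ω → ∀ μ ν : Fin d, μ ≠ ν → conj ((Pdir N c μ *ᵥ z) x) * (Pdir N c ν *ᵥ z) x = 0) :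
    ∑ x ∈ Ω, ‖(LapS N c *ᵥ z) x‖ ^ 2 = Hdiag c Ω z + Hmixed c z := by
  have key : ((∑ x ∈ Ω, ‖(LapS N c *ᵥ z) x‖ ^ 2 : ℝ) : ℂ) = ((Hdiag c Ω z + Hmixed c z : ℝ) : ℂ) := by
    set a : Fin d → Tor N → ℂ := fun μ => Pdir N c μ *ᵥ z with ha
    have hL : ∀ x, (LapS N c *ᵥ z) x = ∑ μ, a μ x := fun x => LapS_mulVec_eq_sum N c z x
    calc ((∑ x ∈ Ω, ‖(LapS N c *ᵥ z) x‖ ^ 2 : ℝ) : ℂ)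
        = ∑ x ∈ Ω, conj ((LapS N c *ᵥ z) x) * (LapS N c *ᵥ z) x := by
          rw [Complex.ofReal_sum]
          refine Finset.sum_congr rfl fun x _ => ?_
          rw [Complex.conj_mul', Complex.ofReal_pow]
      _ = ∑ x ∈ Ω, ∑ μ, ∑ ν, conj (a μ x) * a ν x := by
          refine Finset.sum_congr rfl fun x _ => ?_
          rw [hL x, map_sum, Finset.sum_mul_sum]
      _ = ∑ μ, ∑ ν, ∑ x ∈ Ω, conj (a μ x) * a ν x := by
          rw [Finset.sum_comm]
          refine Finset.sum_congr rfl fun μ _ => ?_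
          rw [Finset.sum_comm]
      _ = ∑ μ, ((∑ x ∈ Ω, conj (a μ x) * a μ x) + ∑ ν ∈ univ.erase μ, ∑ x ∈ Ω, conj (a μ x) * a ν x) := by
          refine Finset.sum_congr rfl fun μ _ => ?_
          rw [← Finset.add_sum_erase _ _ (Finset.mem_univ μ)]
      _ = ∑ μ, ((∑ x ∈ Ω, ((‖a μ x‖ ^ 2 : ℝ) : ℂ)) +
            ∑ ν ∈ univ.erase μ, ((nsq (sdiff N c μ *ᵥ (sdiff N c ν *ᵥ z)) : ℝ) : ℂ)) := by
          refine Finset.sum_congr rfl fun μ _ => ?_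
          congr 1
          · refine Finset.sum_congr rfl fun x _ => ?_
            rw [Complex.conj_mul', Complex.ofReal_pow]
          · refine Finset.sum_congr rfl fun ν hν => ?_
            rw [ha, sum_cross_eq_dotProduct_of_cross c (fun x hx => hcross x hx μ ν (Finset.ne_of_mem_erase hν).symm),
              star_Pdir_dotProduct_Pdir]
      _ = ((Hdiag c Ω z + Hmixed c z : ℝ) : ℂ) := by
          simp only [Hdiag, Hmixed, Complex.ofReal_add, Complex.ofReal_sum, Finset.sum_add_distrib, ha]
  exact_mod_cast key

/-- **DISCRETE `H²` REGULARITY UNDER THE SUPPORT-RELATIVE CROSS CONDITION**: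
`Σ_μ Σ_{x∈Ω}|(∂_μᴴ∂_μ z)(x)|² ≤ Σ_{x∈Ω}|(Δz)(x)|²`. [folklore] -/
theorem hdiag_le_sum_normSq_LapS_of_cross {Ω : Finset (Tor N)} {z : Tor N → ℂ} (c : ℂ)
    (hcross : ∀ x, x ∉ Ω → ∀ μ ν : Fin d, μ ≠ ν → conj ((Pdir N c μ *ᵥ z) x) * (Pdir N c ν *ᵥ z) x = 0) :
    Hdiag c Ω z ≤ ∑ x ∈ Ω, ‖(LapS N c *ᵥ z) x‖ ^ 2 := by
  rw [sum_normSq_LapS_eq_of_cross c hcross]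
  exact le_add_of_nonneg_right (hmixed_nonneg c z)

/-! ## §3 The cut-off form: corner-free away from the zero set of the field -/

/-- **THE LOCALISED `H²` BOUND**: let `z ⊂ Ω` and suppose that at every exterior site `x ∉ Ω` EITHER `Ω` is corner-free at `x` (for all
pairs of directions) OR `z` vanishes at all `2d` neighbours of `x`.  Then `Σ_μ Σ_{x∈Ω}|(∂_μᴴ∂_μ z)(x)|² ≤ Σ_{x∈Ω}|(Δz)(x)|²`.  (USE: `Ω` a
general union of unit blocks, `z = χ·u` with the cut-off `χ ≡ 0` on the lattice neighbourhood of every re-entrant vertex/edge — the only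
exterior sites of a union of blocks violating corner-freeness are the re-entrant ones.) [folklore] -/
theorem hdiag_le_sum_normSq_LapS_local {Ω : Finset (Tor N)} {z : Tor N → ℂ} (hz : SuppIn N Ω z) (c : ℂ)
    (h : ∀ x, x ∉ Ω →
      (∀ μ ν : Fin d, μ ≠ ν → (x + unitVec N μ ∈ Ω ∨ x - unitVec N μ ∈ Ω) → (x + unitVec N ν ∉ Ω ∧ x - unitVec N ν ∉ Ω))
      ∨ (∀ μ : Fin d, z (x + unitVec N μ) = 0 ∧ z (x - unitVec N μ) = 0)) :
    Hdiag c Ω z ≤ ∑ x ∈ Ω, ‖(LapS N c *ᵥ z) x‖ ^ 2 := by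
  refine hdiag_le_sum_normSq_LapS_of_cross c fun x hx μ ν hμν => ?_
  rcases h x hx with hcf | hvan
  · exact cross_eq_zero_of_cornerFreeAt hz c hx (hcf μ ν hμν)
  · exact cross_eq_zero_of_vanish_nhds hz c hx (hvan μ).1 (hvan μ).2

/-- consistency: a corner-free region satisfies the hypothesis of `hdiag_le_sum_normSq_LapS_local` for every field (M-R's theorem is the
special case). [folklore] -/
theorem hdiag_le_sum_normSq_LapS_of_cornerFree {Ω : Finset (Tor N)} (hΩ : CornerFree N Ω) {z : Tor N → ℂ} (hz : SuppIn N Ω z)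
    (c : ℂ) : Hdiag c Ω z ≤ ∑ x ∈ Ω, ‖(LapS N c *ᵥ z) x‖ ^ 2 :=
  hdiag_le_sum_normSq_LapS_local hz c fun x hx => Or.inl fun μ ν hμν => hΩ x hx μ ν hμν

end Summit.QuantumFields.BalabanUV.Beta.GAN24.DirichletBoxRegularityLocal

end
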